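import Summits.KontsevichZagierPeriods.KontsevichZagierPeriods.Theorems.UnfoldedStokesCubeKernelStepStubFibreNullFiniteRankIndep
import Literature.NumberTheory.Transcendental.SemialgebraicAlgebraicPoints
import Literature.NumberTheory.Transcendental.SemialgebraicMaps
import Mathlib.FieldTheory.AlgebraicClosure
import Mathlib.LinearAlgebra.Basis.VectorSpace
import Mathlib.Topology.Algebra.Order.Archimedean

/-!
# `CubeKernelStep` (stmt-KontsevichZagierPeriods-17854), line `Sketch`, stub `stub_fibreNullFiniteRank`

RUNG K1 in the whole FINITE-RANK sector of the crux `CubeKernelStep` (route UnfoldedStokes):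
under the lower layers `K(≤d)`, a closed `(d+1)`-cube representation `t` whose integrand is, on
the cube, a finite sum `∑ᵢ bᵢ(z 0) · aᵢ(tail z)` of separated products with `bᵢ`, `aᵢ` continuous
and `ℚ`-semialgebraic on the closed cubes (NO independence hypothesis on the `bᵢ`), and all of
whose slice values over the parameter `z 0 = s ∈ [0,1]` vanish, is a relation.

Proof (descent to the landed independent case `stub_fibreNullFiniteRankIndep`).
(1) Restrict the `bᵢ` to the RATIONAL points of `[0,1]`; the resulting vectors `wᵢ ∈ ℝ^Q` have
entries algebraic over `ℚ` (values of `ℚ`-semialgebraic functions at rational points,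
`IsSemialgebraicFunOn.isAlgebraic_apply_one`). Choose a maximal linearly independent sub-family
`(w_{idx l})_{l < m}`; every `wᵢ` is a real combination `∑ₗ q i l • w_{idx l}`.
(2) DESCENT: the `q i l` are algebraic. With `K ⊆ ℝ` the field of real algebraic numbers and
`g : ℝ → K` a `K`-linear retraction, applying `g` entrywise to the relation gives
`wᵢ = ∑ₗ g(q i l) • w_{idx l}`, so `q i l = g (q i l) ∈ K` by independence.
(3) By continuity and density of `ℚ`, `bᵢ = ∑ₗ q i l · b_{idx l}` on all of `[0,1]`, and the
restrictions `b_{idx l}|[0,1]` are linearly independent (a relation restricts to the rationals).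
(4) Regroup: on the cube `∑ᵢ bᵢ(z 0) aᵢ(tail z) = ∑ₗ b_{idx l}(z 0) · ãₗ(tail z)` with
`ãₗ = ∑ᵢ q i l · aᵢ` continuous and `ℚ`-semialgebraic (algebraic constants), and apply
`stub_fibreNullFiniteRankIndep`.

References: M. Kontsevich, D. Zagier, *Periods* (2001), §1.2, §4.1.
-/

noncomputable section

set_option linter.dupNamespace false

namespace Summit.KontsevichZagierPeriods.KontsevichZagierPeriods.Cruxes.CubeKernelStep.Layers

open MeasureTheory Set
open scoped BigOperators
open Literature.NumberTheory.Transcendental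
open Literature.NumberTheory.Transcendental.KZ

/-- The closed unit cube of `ℝ¹` is the set of points whose coordinate lies in `[0,1]`.
[folklore] -/
theorem finRankGen_Icc_fin_one :
    Set.Icc (0 : Fin 1 → ℝ) 1 = {z : Fin 1 → ℝ | z 0 ∈ Set.Icc (0:ℝ) 1} := by
  ext z
  simp only [mem_Icc, Pi.le_def, Fin.forall_fin_one, Pi.zero_apply, Pi.one_apply, mem_setOf_eq]

/-- Values at rational points of `[0,1]` of a function `ℚ`-semialgebraic on `[0,1]` are algebraic
over `ℚ`. [folklore] -/
theorem finRankGen_isAlgebraic_ratCast {u : ℝ → ℝ}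
    (hu : IsSemialgebraicFunOn ℚ (Set.Icc (0 : Fin 1 → ℝ) 1) (fun y => u (y 0)))
    (r : ℚ) (hr : (r : ℝ) ∈ Set.Icc (0:ℝ) 1) : IsAlgebraic ℚ (u r) := by
  rw [finRankGen_Icc_fin_one] at hu
  exact hu.isAlgebraic_apply_one hr (isAlgebraic_algebraMap r)

/-- A function continuous on `[0,1]` which vanishes at every rational point of `[0,1]` vanishes
on `[0,1]` (density of `ℚ`). [folklore] -/
theorem finRankGen_eq_zero_of_ratCast {f : ℝ → ℝ} (hf : ContinuousOn f (Set.Icc (0:ℝ) 1))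
    (h : ∀ r : ℚ, (r : ℝ) ∈ Set.Icc (0:ℝ) 1 → f r = 0) :
    ∀ x ∈ Set.Icc (0:ℝ) 1, f x = 0 := by
  have hZ : IsClosed (Set.Icc (0:ℝ) 1 ∩ f ⁻¹' {0}) :=
    hf.preimage_isClosed_of_isClosed isClosed_Icc isClosed_singleton
  have hsub : Set.Ioo (0:ℝ) 1 ∩ Set.range ((↑) : ℚ → ℝ) ⊆ Set.Icc (0:ℝ) 1 ∩ f ⁻¹' {0} := by
    rintro x ⟨hx, r, rfl⟩
    exact ⟨Ioo_subset_Icc_self hx, h r (Ioo_subset_Icc_self hx)⟩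
  have hdense : Dense (Set.range ((↑) : ℚ → ℝ)) := Rat.denseRange_cast
  have hIoo : Set.Ioo (0:ℝ) 1 ⊆ Set.Icc (0:ℝ) 1 ∩ f ⁻¹' {0} :=
    (hdense.open_subset_closure_inter isOpen_Ioo).trans (closure_minimal hsub hZ)
  intro x hx
  have hx' : x ∈ closure (Set.Ioo (0:ℝ) 1) := by
    rw [closure_Ioo zero_ne_one]
    exact hx
  exact (closure_minimal hIoo hZ hx').2

/-- **Descent of real linear relations to algebraic coefficients.** If vectors `u j ∈ ℝ^X` with
entries algebraic over `ℚ` are linearly independent over `ℝ` and `u₀ = ∑ c j • u j` has algebraic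
entries, then the real coefficients `c j` are algebraic: a `K`-linear retraction `g : ℝ → K` onto
the field `K` of real algebraic numbers maps the relation entrywise to one with coefficients
`g (c j) ∈ K`, which coincides with the given one by independence. [folklore] -/
theorem finRankGen_coeff_isAlgebraic {ι X : Type*} [Fintype ι] {u : ι → X → ℝ} {u₀ : X → ℝ}
    (hu : ∀ j x, IsAlgebraic ℚ (u j x)) (hu₀ : ∀ x, IsAlgebraic ℚ (u₀ x))
    (hli : LinearIndependent ℝ u) {c : ι → ℝ} (hc : ∑ j, c j • u j = u₀) (j : ι) :
    IsAlgebraic ℚ (c j) := by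
  classical
  -- a `K`-linear retraction `g : ℝ → K` onto the field `K` of real algebraic numbers
  obtain ⟨g, hg⟩ := LinearMap.exists_leftInverse_of_injective
    (Algebra.linearMap (algebraicClosure ℚ ℝ) ℝ)
    (LinearMap.ker_eq_bot.mpr (by
      rw [Algebra.coe_linearMap]
      exact (algebraMap (algebraicClosure ℚ ℝ) ℝ).injective))
  have hgK : ∀ y : algebraicClosure ℚ ℝ, g (y : ℝ) = y := fun y => by
    have h := LinearMap.congr_fun hg y
    simpa using h
  -- pointwise form of the given relation
  have hcx : ∀ x, ∑ i, c i * u i x = u₀ x := fun x => by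
    have hx := congr_fun hc x
    simpa only [Finset.sum_apply, Pi.smul_apply, smul_eq_mul] using hx
  -- the relation with the coefficients `g (c i) ∈ K`
  have hrel : ∀ x, ∑ i, (g (c i) : ℝ) * u i x = u₀ x := by
    intro x
    have hUmem : ∀ i, u i x ∈ algebraicClosure ℚ ℝ := fun i => mem_algebraicClosure_iff.mpr (hu i x)
    have hU₀mem : u₀ x ∈ algebraicClosure ℚ ℝ := mem_algebraicClosure_iff.mpr (hu₀ x)
    have h1 : u₀ x = ∑ i, (⟨u i x, hUmem i⟩ : algebraicClosure ℚ ℝ) • c i := by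
      rw [← hcx x]
      refine Finset.sum_congr rfl fun i _ => ?_
      rw [IntermediateField.smul_def, smul_eq_mul]
      exact mul_comm _ _
    have h2 : g (u₀ x) = ∑ i, (⟨u i x, hUmem i⟩ : algebraicClosure ℚ ℝ) • g (c i) := by
      rw [h1, map_sum]
      exact Finset.sum_congr rfl fun i _ => g.map_smul _ _
    have h3 : (⟨u₀ x, hU₀mem⟩ : algebraicClosure ℚ ℝ) =
        ∑ i, (⟨u i x, hUmem i⟩ : algebraicClosure ℚ ℝ) * g (c i) := by
      rw [← hgK ⟨u₀ x, hU₀mem⟩]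
      simpa only [smul_eq_mul] using h2
    have h4 := congr_arg (fun y : algebraicClosure ℚ ℝ => (y : ℝ)) h3
    simp only [AddSubmonoidClass.coe_finsetSum, MulMemClass.coe_mul] at h4
    rw [h4]
    exact Finset.sum_congr rfl fun i _ => mul_comm _ _
  -- compare the two relations using independence
  have hzero : ∑ i, (c i - g (c i)) • u i = 0 := by
    funext x
    simp only [Finset.sum_apply, Pi.smul_apply, smul_eq_mul, Pi.zero_apply, sub_mul,
      Finset.sum_sub_distrib]
    rw [hcx x, hrel x, sub_self]
  have hcj : c j - g (c j) = 0 := Fintype.linearIndependent_iff.mp hli _ hzero j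
  rw [sub_eq_zero] at hcj
  rw [hcj]
  exact mem_algebraicClosure_iff.mp (g (c j)).2

/-- **Descent lemma for a finite family of parameter functions.** For continuous functions
`bᵢ : [0,1] → ℝ` (`i < k`) with `y ↦ bᵢ (y 0)` `ℚ`-semialgebraic on the closed unit cube of `ℝ¹`,
there is a sub-family `b ∘ idx` (`idx : Fin m → Fin k`) whose restrictions to `[0,1]` are
linearly independent over `ℝ` and REAL-ALGEBRAIC coefficients `q i l` with
`bᵢ = ∑ₗ q i l · b_{idx l}` on `[0,1]`: a maximal independent sub-family of the restrictions to
the rational points of `[0,1]` (where all values are algebraic), descent of the coefficients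
(`finRankGen_coeff_isAlgebraic`), and continuity plus density of `ℚ`. [folklore] -/
theorem finRankGen_descent {k : ℕ} (b : Fin k → ℝ → ℝ)
    (hb_sa : ∀ i, IsSemialgebraicFunOn ℚ (Set.Icc (0 : Fin 1 → ℝ) 1) (fun y => b i (y 0)))
    (hb : ∀ i, ContinuousOn (b i) (Set.Icc (0:ℝ) 1)) :
    ∃ (m : ℕ) (idx : Fin m → Fin k) (q : Fin k → Fin m → ℝ),
      LinearIndependent ℝ (fun l => (Set.Icc (0:ℝ) 1).restrict (b (idx l))) ∧
      (∀ i l, IsAlgebraic ℚ (q i l)) ∧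
      ∀ i, ∀ s ∈ Set.Icc (0:ℝ) 1, b i s = ∑ l, q i l * b (idx l) s := by
  classical
  -- the rational points of `[0,1]` and the restrictions `w i` of the `b i` to them
  let Q : Set ℝ := Set.Icc (0:ℝ) 1 ∩ Set.range ((↑) : ℚ → ℝ)
  let incl : Q → Set.Icc (0:ℝ) 1 := fun x => ⟨x.1, x.2.1⟩
  let w : Fin k → Q → ℝ := fun i x => b i x.1
  have hw_alg : ∀ i (x : Q), IsAlgebraic ℚ (w i x) := by
    rintro i ⟨x, hx01, r, rfl⟩
    exact finRankGen_isAlgebraic_ratCast (hb_sa i) r hx01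
  -- (1) a maximal independent sub-family of `w`, reindexed by `Fin m`
  obtain ⟨S, -, -, hspan, hliS⟩ :=
    exists_linearIndepOn_extension (linearIndepOn_empty ℝ w) (Set.empty_subset Set.univ)
  obtain ⟨m, ⟨e⟩⟩ := Finite.exists_equiv_fin S
  have hli_idx : LinearIndependent ℝ (w ∘ fun l => (e.symm l : Fin k)) :=
    hliS.linearIndependent.comp e.symm e.symm.injective
  have hrange : Set.range (w ∘ fun l => (e.symm l : Fin k)) = w '' S := by
    rw [show (w ∘ fun l => (e.symm l : Fin k)) = (fun x : S => w x) ∘ e.symm from rfl,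
      EquivLike.range_comp, ← Set.image_eq_range]
  have hmem : ∀ i, w i ∈ Submodule.span ℝ (Set.range (w ∘ fun l => (e.symm l : Fin k))) :=
    fun i => by
      rw [hrange]
      exact hspan ⟨i, Set.mem_univ _, rfl⟩
  choose q hq using fun i => (Submodule.mem_span_range_iff_exists_fun ℝ).mp (hmem i)
  -- (2) the coefficients are algebraic
  have hq_alg : ∀ i l, IsAlgebraic ℚ (q i l) := fun i l =>
    finRankGen_coeff_isAlgebraic (u := w ∘ fun l => (e.symm l : Fin k)) (u₀ := w i)
      (fun l x => hw_alg (e.symm l : Fin k) x) (hw_alg i) hli_idx (hq i) l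
  -- (3) the relations hold on all of `[0,1]`, by continuity and density of `ℚ`
  have hb_eq : ∀ i, ∀ s ∈ Set.Icc (0:ℝ) 1, b i s = ∑ l, q i l * b (e.symm l : Fin k) s := by
    intro i
    have hcont : ContinuousOn (fun s => b i s - ∑ l, q i l * b (e.symm l : Fin k) s)
        (Set.Icc (0:ℝ) 1) :=
      (hb i).sub (continuousOn_finsetSum _ fun l _ => continuousOn_const.mul (hb _))
    have hrat : ∀ r : ℚ, (r : ℝ) ∈ Set.Icc (0:ℝ) 1 →
        b i r - ∑ l, q i l * b (e.symm l : Fin k) r = 0 := by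
      intro r hr
      have hx := congr_fun (hq i) ⟨r, hr, r, rfl⟩
      simp only [Finset.sum_apply, Pi.smul_apply, smul_eq_mul, Function.comp_apply] at hx
      rw [sub_eq_zero]
      exact hx.symm
    intro s hs
    exact sub_eq_zero.mp (finRankGen_eq_zero_of_ratCast hcont hrat s hs)
  -- the restrictions to `[0,1]` of the sub-family are independent: restrict further to `Q`
  have hli : LinearIndependent ℝ (fun l => (Set.Icc (0:ℝ) 1).restrict (b (e.symm l : Fin k))) := by
    refine LinearIndependent.of_comp (LinearMap.funLeft ℝ ℝ incl) ?_
    exact hli_idx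
  exact ⟨m, fun l => (e.symm l : Fin k), q, hli, hq_alg, hb_eq⟩

/-- RUNG (K1 in the whole finite-rank sector) of the crux `CubeKernelStep`: **a fibre-null
finite-rank family is a relation.** Under `K(≤d)` (`d ≥ 1`), a representation on the closed
`(d+1)`-cube whose integrand is `∑_{i<k} bᵢ(z 0) · aᵢ(tail z)` with `bᵢ`, `aᵢ` continuous and
`ℚ`-semialgebraic on the closed cubes, and which is fibre-null over `z 0`, is a relation: by the
descent lemma `finRankGen_descent` the integrand regroups on the cube as
`∑ₗ b_{idx l}(z 0) · ãₗ(tail z)` with `b_{idx l}|[0,1]` linearly independent and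
`ãₗ = ∑ᵢ q i l · aᵢ` continuous and `ℚ`-semialgebraic (the `q i l` are real algebraic), and the
independent case `stub_fibreNullFiniteRankIndep` applies. [cite: KontsevichZagier2001, §1.2] -/
theorem stub_fibreNullFiniteRank :
    ∀ d : ℕ, 1 ≤ d →
      (∀ (M : ℕ), M ≤ d → ∀ (a : IntegralRep M),
        a.domain = Set.pi Set.univ (fun _ : Fin M => Set.Icc (0:ℝ) 1) →
        ContinuousOn a.integrand a.domain → a.value = 0 → of a ∈ relations) →
      ∀ (k : ℕ) (b : Fin k → ℝ → ℝ) (a : Fin k → (Fin d → ℝ) → ℝ),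
        (∀ i, IsSemialgebraicFunOn ℚ (Set.Icc (0 : Fin 1 → ℝ) 1) (fun y => b i (y 0))) →
        (∀ i, IsSemialgebraicFunOn ℚ (Set.pi Set.univ (fun _ : Fin d => Set.Icc (0:ℝ) 1)) (a i)) →
        (∀ i, ContinuousOn (b i) (Set.Icc (0:ℝ) 1)) →
        (∀ i, ContinuousOn (a i) (Set.pi Set.univ (fun _ : Fin d => Set.Icc (0:ℝ) 1))) →
        ∀ (t : IntegralRep (d + 1)),
          t.domain = Set.pi Set.univ (fun _ : Fin (d + 1) => Set.Icc (0:ℝ) 1) →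
          Set.EqOn t.integrand (fun z => ∑ i, b i (z 0) * a i (Fin.tail z)) t.domain →
          (∀ s ∈ Set.Icc (0:ℝ) 1, sliceValue t s = 0) → of t ∈ relations := by
  intro d hd hK k b a hb_sa ha_sa hb ha t htd heq hslice
  -- descent: an independent sub-family `b ∘ idx` and real-algebraic coefficients `q`
  obtain ⟨m, idx, q, hli, hq_alg, hb_eq⟩ := finRankGen_descent b hb_sa hb
  have hcube : Literature.ModelTheory.ExponentialFields.IsSemialgebraic ℚ
      (Set.pi Set.univ (fun _ : Fin d => Set.Icc (0:ℝ) 1)) := by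
    rw [← KZ.cube_eq_pi]
    exact KZ.isSemialgebraic_cube
  -- the regrouped family `ã l = ∑ i, q i l • a i`
  have ha'_sa : ∀ l, IsSemialgebraicFunOn ℚ (Set.pi Set.univ (fun _ : Fin d => Set.Icc (0:ℝ) 1))
      (fun x => ∑ i, q i l * a i x) := fun l =>
    isSemialgebraicFunOn_finset_sum _ hcube fun i _ =>
      IsSemialgebraicFunOn.mul_holds (isSemialgebraicFunOn_const_of_isAlgebraic hcube (hq_alg i l))
        (ha_sa i)
  have ha' : ∀ l, ContinuousOn (fun x => ∑ i, q i l * a i x)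
      (Set.pi Set.univ (fun _ : Fin d => Set.Icc (0:ℝ) 1)) := fun l =>
    continuousOn_finsetSum _ fun i _ => continuousOn_const.mul (ha i)
  -- the regrouped integrand
  have heq' : Set.EqOn t.integrand
      (fun z => ∑ l, b (idx l) (z 0) * ∑ i, q i l * a i (Fin.tail z)) t.domain := by
    intro z hz
    have hz0 : z 0 ∈ Set.Icc (0:ℝ) 1 := by
      have hz' := hz
      rw [htd, Set.mem_univ_pi] at hz'
      exact hz' 0
    rw [heq hz]
    calc ∑ i, b i (z 0) * a i (Fin.tail z)
        = ∑ i, ∑ l, b (idx l) (z 0) * (q i l * a i (Fin.tail z)) := by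
          refine Finset.sum_congr rfl fun i _ => ?_
          rw [hb_eq i _ hz0, Finset.sum_mul]
          exact Finset.sum_congr rfl fun l _ => by ring
      _ = ∑ l, b (idx l) (z 0) * ∑ i, q i l * a i (Fin.tail z) := by
          rw [Finset.sum_comm]
          exact Finset.sum_congr rfl fun l _ => by rw [Finset.mul_sum]
  exact stub_fibreNullFiniteRankIndep d hd hK m (fun l => b (idx l)) (fun l x => ∑ i, q i l * a i x)
    (fun l => hb_sa (idx l)) ha'_sa (fun l => hb (idx l)) ha' hli t htd heq' hslice

end Summit.KontsevichZagierPeriods.KontsevichZagierPeriods.Cruxes.CubeKernelStep.Layers
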